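import Literature.AlgebraicGeometry.Frobenioids.Prop53Sub
import Literature.AlgebraicGeometry.Frobenioids.RealificationMonoidOn
import Literature.AlgebraicGeometry.Frobenioids.DivisorPullbacksReflect
import Literature.AlgebraicGeometry.Frobenioids.ArithmeticFrobenioidHypotheses
import Literature.AlgebraicGeometry.Frobenioids.GeometricFrobenioidNonDilating
import HarnessLib

/-!
# Frobenioids I, Prop. 5.3 for the motivating examples: `PullbacksReflectDvd` HOLDS, hence "the divisor monoid
# `Φ^rlf`" IS a monoid on `D`, for the divisor monoids of Examples 6.1 and 6.3 — PROOF

Mochizuki, *The geometry of Frobenioids I: the general theory*, Kyushu J. Math. **62** (2008) 293–400, Prop. 5.3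
p. 103 ("the divisorial monoid `Φ^rlf`"), Ex. 6.1 p. 109, Ex. 6.3 p. 113. [cite: MochizukiFrdI2008, Prop. 5.3 p.103]

PROOF-ONLY (seat abc-iut-L6-t10 gen 2, S3 sub-DAG holder; L1-lead R89 (1)(r3)). Discharges the NAMED hypothesis
`FrdI.Prop53Sub.PullbacksReflectDvd` (abc-iut-w5-d137's `Prop53Sub.lean`, introduced after P53-F1) at THE arithmetic
divisor monoid `arithDivisorFunctor F K` of Ex. 6.3 and at THE geometric divisor monoid `geomDivisorFunctor Γ` of
Ex. 6.1, by the unfolded theorems of `DivisorPullbacksReflect.lean`. With `IsMonoidOn` (landed: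
`arithDivisorFunctor_isMonoidOn`, `geomDivisorFunctor_isMonoidOn`) these are the two inputs of
abc-iut-w5-d137's `isMonoidOn_rlfFunctor_of_reflects` (`RealificationMonoidOn.lean`, row P53/L02a), whence the
INSTANCES `arithRlfFunctor_isMonoidOn` / `geomRlfFunctor_isMonoidOn`: **`Φ^rlf` is a monoid on `D`** for
`C_{K/F}` (Thm. 6.4 (ii) needs `C^rlf`) and for `C_{K̃/K}`. No definitions; nothing here bears on [IUTchIII] or abc.
-/

noncomputable section

namespace Literature.AlgebraicGeometry.Frobenioids

open CategoryTheory Opposite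

section Arith

variable (F : Type) [Field F] [NumberField F] (K : Type) [Field K] [Algebra F K]

/-- **`PullbacksReflectDvd` holds for the arithmetic divisor monoid of Ex. 6.3**: `σ^* a ∣ σ^* b ⟹ a ∣ b`.
[cite: MochizukiFrdI2008, Ex. 6.3 p.113] -/
theorem pullbacksReflectDvd_arith : FrdI.Prop53Sub.PullbacksReflectDvd (arithDivisorFunctor F K) :=
  fun _ _ σ a b h => arithDivisorFunctor_pull_dvd_imp F K σ a b h

/-- **"The divisor monoid `Φ^rlf`" (Prop. 5.3 p. 103) IS a monoid on `D = B(Gal(K/F))⁰` for the arithmetic `Φ` of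
Ex. 6.3** (`K/F` Galois), for any perf-factoriality witness `hΦ`: row P53/L02a (`isMonoidOn_rlfFunctor_of_reflects`)
at `arithDivisorFunctor_isMonoidOn` + `pullbacksReflectDvd_arith`. [cite: MochizukiFrdI2008, Prop. 5.3 p.103] -/
theorem arithRlfFunctor_isMonoidOn [IsGalois F K]
    (hΦ : ∀ X : (FinSubextCat F K)ᵒᵖ, IsPerfFactorial ((arithDivisorFunctor F K).obj X)) :
    IsMonoidOn (Literature.AnabelianGeometry.EtaleTheta.rlfFunctor (arithDivisorFunctor F K) hΦ) :=
  isMonoidOn_rlfFunctor_of_reflects hΦ (arithDivisorFunctor_isMonoidOn F K) (pullbacksReflectDvd_arith F K)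

end Arith

section Geom

variable {K : Type} [Field K] {Kt : Type} [Field Kt] [Algebra K Kt] (Γ : GeometricDivisorData K Kt)

/-- **`PullbacksReflectDvd` holds for the geometric divisor monoid of Ex. 6.1**: `σ^* a ∣ σ^* b` in `Φ(L)` ⟹
`a ∣ b` in `Φ(M)`. [cite: MochizukiFrdI2008, Ex. 6.1 p.109] -/
theorem pullbacksReflectDvd_geom : FrdI.Prop53Sub.PullbacksReflectDvd (geomDivisorFunctor Γ) :=
  fun _ _ σ a b h => Γ.pullPhi_dvd_imp σ a b h

/-- **"The divisor monoid `Φ^rlf`" IS a monoid on `D` for the geometric `Φ` of Ex. 6.1** (`K̃/K` Galois), for any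
perf-factoriality witness `hΦ`: row P53/L02a at `geomDivisorFunctor_isMonoidOn` + `pullbacksReflectDvd_geom`.
[cite: MochizukiFrdI2008, Prop. 5.3 p.103] -/
theorem geomRlfFunctor_isMonoidOn [IsGalois K Kt]
    (hΦ : ∀ X : (FinSubextCat K Kt)ᵒᵖ, IsPerfFactorial ((geomDivisorFunctor Γ).obj X)) :
    IsMonoidOn (Literature.AnabelianGeometry.EtaleTheta.rlfFunctor (geomDivisorFunctor Γ) hΦ) :=
  isMonoidOn_rlfFunctor_of_reflects hΦ (geomDivisorFunctor_isMonoidOn Γ) (pullbacksReflectDvd_geom Γ)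

end Geom

end Literature.AlgebraicGeometry.Frobenioids

end
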